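import Summits.RiemannHypothesis.RiemannHypothesis.Theorems.PfPersistencePerronFakeNodelessSmallWindow
import HarnessLib

/-!
# PF persistence — PERRON-FAKE (S6): the Jentzsch / Perron–Frobenius SOURCE CRITERION for the FULL
# windowed form of an ARBITRARY weight table; the domination hypothesis BY NAME, and what it is worth

`pub-rhpf` cell, unit `pub-rhpf-prover-perron` (S6; CASE-DAG §6 row PERRON-FAKE; leaves G1.01 / G1.12 /
G1.13, node G1.PERRON).  Last of four files: part 1 `…PerronFakeNodelessFold` (lobe-balance law),
part 2 `…PerronFakeNodelessCriterion` (criterion, dichotomy, obstruction, even channel, ζ instance)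
and part 4 `…PerronFakeNodelessSmallWindow` (the hypothesis PROVED on `0 < a ≤ 1/8`) are
definition-free; THIS file names the objects (the only `def`s of the four) and assembles.
**Mechanism / rigidity campaign; no RH claims.**  RH-free: Mathlib + proved tree files only; the only
named `Prop`s used as hypotheses are the ones DEFINED here (flagged TYPED).

## What is proved (labels: PROVED = kernel theorem of this file; TYPED = a named `Prop` of this file;
## DERIVED = a number computed from the definitions, not used in any proof)

Fix a window `a` and a REAL weight table `w : ℕ → ℝ` (no sign condition is needed anywhere; `w ≥ 0`
only makes the source larger, `tableSource_prime_nonneg`, `tableSource_mono`).  The FULL closed form of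
the table read at `[-a, a]` is the tree's `Q^w_a = tableClosedForm a w = P + 𝓔^w_a − M^w_a‖·‖²`
(`PfPersistenceEdgeLawTables`: pole form `P = weilPoleForm`, pure-jump energy
`𝓔^w_a = tableDirichletEnergy a w` = archimedean kernel `ρ = weilArchDensity` + the atoms `w(n)δ_{log n}`,
`log n < 2a`; killing constant `M^w_a`).  Its form domain is theory-1's finite-energy window class
`coreAdm a` (`PfPersistenceMarkovCore`).  For a real `u` put `u⁺ = max(u,0)`, `u⁻ = max(−u,0)` and
define the **table source** (`tableSource`)

  `S^w_u(y) = ∫_{(0,∞)} ρ(t)(u⁺(y+t) + u⁺(y−t)) dt + Σ_{log n < 2a} w(n)(u⁺(y+log n) + u⁺(y−log n))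
              − 2∫ u⁺(x) cosh((x−y)/2) dx`

(Markov attraction exerted on the point `y` by the positive lobe, minus the polar repulsion).

1. (PROVED, part 1 + `tableClosedForm_abs_sub_eq` here) **lobe-balance law**: for real `u` in the class,
   `Q^w_a(|u|) − Q^w_a(u) = −4 ∫ u⁻(y) S^w_u(y) dy` (and `u⁻S^w_u ∈ L¹`): folding the negative lobe onto
   the positive one GAINS the Markov attraction between the lobes (archimedean kernel at every length
   plus every atom of the table) and LOSES the polar repulsion; `S^w_u` is their pointwise balance.
2. (PROVED, part 2 `ae_nonneg_of_source_pos` + `IsTableGround.ae_nonneg_of_source_pos` here) **Jentzsch's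
   criterion, form-domain version, for every table and every window**: if folding does not lower the
   form (`Q(u) ≤ Q(|u|)`, automatic for a form-domain ground state `IsTableGround a w u` — a normalised
   minimiser of `Q^w_a` over `coreAdm a`, `IsTableGround.fold_le`) and `S^w_u > 0` a.e. on `{u < 0}`,
   then `u ≥ 0` a.e.  Obstruction form (PROVED, `IsTableGround.frequently_source_nonpos_of_not_aeOneSigned`):
   **a real ground state that is NOT a.e. one-signed has `S^w_u ≤ 0` on a non-null part of `{u < 0}` AND
   `S^w_{−u} ≤ 0` on a non-null part of `{u > 0}`** — each lobe must contain a non-null region where the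
   polar repulsion of the other lobe beats its Markov attraction.  No Euler–Lagrange equation, no
   coercivity constant, no truncation of `ρ`, and no Beurling–Deny property of the full form (PROVED
   false for `a ≥ 3/10`, `sw_not_signImproving_of_ge`) is used.
3. (TYPED, `PerronSourceDominated a w`) **the domination hypothesis BY NAME** (S6 brief: "state the
   domination hypothesis by name if it is not provable outright"): every real form-domain ground state
   has, for one of `±u`, a.e.-positive source on its negative set; (PROVED,
   `aeOneSigned_of_perronSourceDominated`, `perronFake_allWindows`, `perronFake_witness`) it gives nodal
   count `0` of EVERY real ground state (`AeOneSigned`), at every window where it is assumed, and the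
   (U)-column sentence of G1.01 under the typed negativity input `NegativeAt a w`.
4. (PROVED, `perronSourceDominated_iff`) **HONESTY THEOREM — what the named hypothesis is worth**:
   `PerronSourceDominated a w ↔ AllGroundStatesOneSigned a w`.  For a one-signed state the source
   condition is void (there is no second lobe), so AT THE GROUND-STATE LEVEL NO DOMINATION STATEMENT IS
   WEAKER THAN THE CONCLUSION: the named input is a quantitative READING of nodal count `0` (item 2 says
   where a node could sit), not a cheaper sufficient condition; an adjudicator upgrading a "served
   windows (PERRON)" clause under this input is assuming all-window nodelessness itself (DATA of the
   cell), now with a mechanism attached.  TABLE-level blanket dominations are not available either: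
   two thin lobes at mutual distance `d` have cross source `≈ (ρ(d) − 2cosh(·)cosh(·))·mass < 0` as soon
   as `ρ(d) < 2`, i.e. `d ≥ 3/10` (`ρ(3/10) = 1.907…`, DERIVED), so "attraction beats repulsion for all
   lobe pairs" fails at every table beyond windows `a ≈ 0.15`; and the outright statement "archimedean
   part + attractive measure ⇒ nodeless at all windows" contains ζ's own table, for which all-window
   one-signedness is the RH-strength (T1) statement of the tree (`riemannHypothesis_of_evenOneSignedWindows`)
   — hence "not provable outright" in the brief's sense, and typed.
5. (PROVED, §3) the **EVEN sector** (the brief's "even bottom state"): `IsTableEvenGround` (minimiser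
   among even members of the class), `IsTableEvenGround.fold_le / .ae_nonneg_of_source_pos /
   .frequently_source_nonpos_of_not_aeOneSigned`, `PerronSourceDominatedEven` (TYPED) with
   `aeOneSigned_of_perronSourceDominatedEven`, the honesty theorem `perronSourceDominatedEven_iff`,
   and the even polar structure `tableSource_even` (part 2 `integral_posPart_mul_cosh_of_even`):
   `S^w_u(y) = (Markov part)(y) − 2cosh(y/2)·⟨u⁺, cosh(·/2)⟩` (the `sinh`-moment of an even function
   vanishes) — in the even sector the repulsion is the single rank-one channel `cosh(·/2)`.
6. (PROVED, §4; part 2) **the typed notion is the tree's for ζ**: `isTableGround_zetaTable_of_isWeilGroundState`,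
   `isTableGround_zetaTable_weilTrunc` — every ground state of the windowed Weil form
   (`IsWeilGroundState`, via its open-window truncation) is an `IsTableGround a zetaTable` state, by the
   landed form-domain theorems `stub_groundStateEnergy` / `stub_formDomainPos` (route WeilWindowFlow);
   with `w = Λ(n)n^{-1/2}` item 2 is the tree's `PolarPerronFrobenius.swg_ae_nonneg_of_source_pos`
   (GroundBarta G2), whose table-independent fold lemmas (`…GroundFold`, `swg_archGain_eq`) are reused.

7. (PROVED, §5; part 4) **the named hypothesis holds outright on `0 < a ≤ 1/8`, for every real
   table**: `allGroundStatesOneSigned_smallWindow`, `allEvenGroundStatesOneSigned_smallWindow`,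
   `perronSourceDominated_smallWindow` — the INTEGRATED lobe-balance law gives
   `(ρ(2a) − 2cosh a)(∫u⁺)(∫u⁻) ≤ 0`, and `2cosh a < ρ(2a)` is certified for `a ≤ 1/8` (true
   threshold `a ≈ 0.139`; no prime length enters below `log 2 / 2`, so no table acts there).

Instances are NOT claimed: that the mv811 `τ = 4` Beurling object (FK-PERRON) or the twins B23 / U23
satisfy `PerronSourceDominated` (equivalently: have nodeless ground states) at every window is DATA of
the cell (nodal count `0` on the served windows, in-model), not a theorem of this file; existence of
ground states for a general table (GAL-0) is not addressed (for ζ: `isTableGround_zetaTable_weilTrunc`).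

Why not the resolvent / semigroup route: "(H − E)⁻¹ positivity-improving below the ground level" is
EQUIVALENT to "ground state simple and nodeless" (Krein–Rutman and its converse), so no weaker than the
conclusion, and has no variational rendering in the tree; Beurling–Deny is refuted for `a ≥ 3/10`.

## References (cited per the brief; the proofs below do not invoke them as facts)

* R. Jentzsch, *Über Integralgleichungen mit positivem Kern*, J. reine angew. Math. 141 (1912) 235–244
  (a positive kernel has a simple top eigenvalue with a positive eigenfunction).
* M. G. Krein, M. A. Rutman, *Linear operators leaving invariant a cone in a Banach space*, Uspekhi
  Mat. Nauk 3 (1948) no. 1(23), 3–95; AMS Transl. 26 (1950).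
* M. Reed, B. Simon, *Methods of Modern Mathematical Physics IV: Analysis of Operators* (1978),
  §XIII.12, Thms XIII.43–44 (positivity-improving semigroups / resolvents ⇒ nodeless simple ground state)
  and Thm XIII.50 (Beurling–Deny criteria).
* E. Bombieri, Rend. Mat. Acc. Lincei (9) 11 (2000) 183–233, Thm 2 (p. 193) (the windowed form).
* Z.-Q. Chen, M. Fukushima, *Symmetric Markov Processes, Time Change, and Boundary Theory* (2012),
  Thm 1.1.3(e) (normal contractions `f ↦ |f|` of a Dirichlet form).
-/


set_option linter.dupNamespace false

noncomputable section

open MeasureTheory Set Filter Complex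
open scoped Real Topology

namespace Summit.RiemannHypothesis.RiemannHypothesis.Theorems.PfPersistence

open Literature.NumberTheory.LFunctions
open Summit.RiemannHypothesis.RiemannHypothesis.Theorems.WeilGroundStateMarkovPart
open Summit.RiemannHypothesis.RiemannHypothesis.Theorems.PolarPerronFrobenius

/-! ## §1 The named objects (the only definitions of the four files; all TYPED) -/

/-- The **table source** of a real window function `u` for the table `w` at the window `a`, at `y`:
`S^w_u(y) = ∫_{(0,∞)} ρ(t)(u⁺(y+t)+u⁺(y−t)) dt + Σ_{log n<2a} w(n)(u⁺(y+log n)+u⁺(y−log n))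
− 2∫ u⁺(x)cosh((x−y)/2) dx` — Markov attraction exerted on `y` by the positive lobe minus the polar
repulsion (ζ: `w = Λ(n)n^{-1/2}`, the source of `swg_ae_nonneg_of_source_pos`). [folklore] -/
def tableSource (a : ℝ) (w : ℕ → ℝ) (u : ℝ → ℝ) (y : ℝ) : ℝ :=
  (∫ t in Ioi (0 : ℝ), weilArchDensity t * (max (u (y + t)) 0 + max (u (y - t)) 0)) +
    (∑ n ∈ weilPrimeIndex a, w n * (max (u (y + Real.log n)) 0 + max (u (y - Real.log n)) 0)) -
    2 * ∫ x, max (u x) 0 * Real.cosh ((x - y) / 2)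

/-- **Form-domain ground state of the FULL closed form of the table `w` at the window `a`**: a
normalised member of the finite-energy window class (`coreAdm a`) minimising the Rayleigh quotient of
`tableClosedForm a w` over that class. [folklore] -/
def IsTableGround (a : ℝ) (w : ℕ → ℝ) (U : ℝ → ℂ) : Prop :=
  coreAdm a U ∧ (∫ x, ‖U x‖ ^ 2 = (1 : ℝ)) ∧
    ∀ v : ℝ → ℂ, coreAdm a v → tableClosedForm a w U * (∫ x, ‖v x‖ ^ 2) ≤ tableClosedForm a w v

/-- **Even-sector form-domain ground state** (the brief's "even bottom state"): an EVEN normalised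
member of the class minimising the Rayleigh quotient among the EVEN members. [folklore] -/
def IsTableEvenGround (a : ℝ) (w : ℕ → ℝ) (U : ℝ → ℂ) : Prop :=
  coreAdm a U ∧ (∀ x, U (-x) = U x) ∧ (∫ x, ‖U x‖ ^ 2 = (1 : ℝ)) ∧
    ∀ v : ℝ → ℂ, coreAdm a v → (∀ x, v (-x) = v x) →
      tableClosedForm a w U * (∫ x, ‖v x‖ ^ 2) ≤ tableClosedForm a w v

/-- A real function is **a.e. one-signed** (`≥ 0` a.e. or `≤ 0` a.e.): nodal count `0`. [folklore] -/
def AeOneSigned (u : ℝ → ℝ) : Prop :=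
  (∀ᵐ y : ℝ, 0 ≤ u y) ∨ (∀ᵐ y : ℝ, u y ≤ 0)

/-- **THE DOMINATION HYPOTHESIS, BY NAME (TYPED; S6 brief).**  Every real form-domain ground state `u`
of the full closed form of the table `w` at the window `a` has, for one of `±u`, an a.e.-POSITIVE
table source on its negative set (the Markov attraction of the dominant lobe beats the polar repulsion
wherever the other lobe lives).  By `perronSourceDominated_iff` it is EQUIVALENT to nodal count `0` of
every real ground state (`AllGroundStatesOneSigned`): a reading, not a weakening. [folklore] -/
def PerronSourceDominated (a : ℝ) (w : ℕ → ℝ) : Prop :=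
  ∀ u : ℝ → ℝ, Measurable u → IsTableGround a w (fun x ↦ ((u x : ℝ) : ℂ)) →
    (∀ᵐ y : ℝ, u y < 0 → 0 < tableSource a w u y) ∨
      (∀ᵐ y : ℝ, 0 < u y → 0 < tableSource a w (fun x ↦ -u x) y)

/-- The even-sector domination hypothesis, BY NAME (TYPED). [folklore] -/
def PerronSourceDominatedEven (a : ℝ) (w : ℕ → ℝ) : Prop :=
  ∀ u : ℝ → ℝ, Measurable u → IsTableEvenGround a w (fun x ↦ ((u x : ℝ) : ℂ)) →
    (∀ᵐ y : ℝ, u y < 0 → 0 < tableSource a w u y) ∨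
      (∀ᵐ y : ℝ, 0 < u y → 0 < tableSource a w (fun x ↦ -u x) y)

/-- Nodal count `0` of every real form-domain ground state (TYPED; the PERRON column's conclusion as a
named input). [folklore] -/
def AllGroundStatesOneSigned (a : ℝ) (w : ℕ → ℝ) : Prop :=
  ∀ u : ℝ → ℝ, Measurable u → IsTableGround a w (fun x ↦ ((u x : ℝ) : ℂ)) → AeOneSigned u

/-- Nodal count `0` of every real even-sector ground state (TYPED). [folklore] -/
def AllEvenGroundStatesOneSigned (a : ℝ) (w : ℕ → ℝ) : Prop :=
  ∀ u : ℝ → ℝ, Measurable u → IsTableEvenGround a w (fun x ↦ ((u x : ℝ) : ℂ)) → AeOneSigned u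

/-- **Typed negativity input (S6 brief)**: the full closed form of the table `w` is negative on some
member of the finite-energy window class at the window `a`. [folklore] -/
def NegativeAt (a : ℝ) (w : ℕ → ℝ) : Prop :=
  ∃ v : ℝ → ℂ, coreAdm a v ∧ tableClosedForm a w v < 0

/-! ## §2 The source: remarks -/

section Source

variable {a : ℝ} {w : ℕ → ℝ}

/-- **The source is monotone UP the weight cone** (at fixed `u`). [folklore] -/
theorem tableSource_mono {w' : ℕ → ℝ} (hww : ∀ n ∈ weilPrimeIndex a, w n ≤ w' n) (u : ℝ → ℝ)
    (y : ℝ) : tableSource a w u y ≤ tableSource a w' u y := by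
  unfold tableSource
  have h : ∑ n ∈ weilPrimeIndex a, w n * (max (u (y + Real.log n)) 0 + max (u (y - Real.log n)) 0) ≤
      ∑ n ∈ weilPrimeIndex a, w' n * (max (u (y + Real.log n)) 0 + max (u (y - Real.log n)) 0) :=
    Finset.sum_le_sum fun n hn ↦ mul_le_mul_of_nonneg_right (hww n hn)
      (add_nonneg (le_max_right _ _) (le_max_right _ _))
  linarith

/-- For a non-negative table the source dominates its table-free part. [folklore] -/
theorem tableSource_ge_archPolar (hw : ∀ n ∈ weilPrimeIndex a, 0 ≤ w n) (u : ℝ → ℝ) (y : ℝ) :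
    (∫ t in Ioi (0 : ℝ), weilArchDensity t * (max (u (y + t)) 0 + max (u (y - t)) 0)) -
        2 * ∫ x, max (u x) 0 * Real.cosh ((x - y) / 2) ≤ tableSource a w u y := by
  have h := tableSource_prime_nonneg hw u y
  unfold tableSource
  linarith

/-- **The source of an EVEN state** (even polar channel, part 2): `S^w_u(y) = (Markov part)(y) −
2cosh(y/2)∫u⁺(x)cosh(x/2) dx`. [folklore] -/
theorem tableSource_even {u : ℝ → ℝ} (hu2 : MemLp u 2 volume)
    (hus : ∀ᵐ x : ℝ, x ∉ Icc (-a) a → u x = 0) (he : ∀ x, u (-x) = u x) (y : ℝ) :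
    tableSource a w u y =
      (∫ t in Ioi (0 : ℝ), weilArchDensity t * (max (u (y + t)) 0 + max (u (y - t)) 0)) +
        (∑ n ∈ weilPrimeIndex a, w n * (max (u (y + Real.log n)) 0 + max (u (y - Real.log n)) 0)) -
        2 * (Real.cosh (y / 2) * ∫ x, max (u x) 0 * Real.cosh (x / 2)) := by
  unfold tableSource
  rw [integral_posPart_mul_cosh_of_even hu2 hus he]

end Source

/-! ## §3 The lobe-balance law and the criterion, named; nodelessness under the named hypothesis -/

section Perron

variable {a : ℝ} {w : ℕ → ℝ} {u : ℝ → ℝ}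

/-- **Lobe-balance law (PROVED, part 1)**: `Q^w_a(|u|) − Q^w_a(u) = −4∫u⁻S^w_u`. [folklore] -/
theorem tableClosedForm_abs_sub_eq (w : ℕ → ℝ) (hum : Measurable u)
    (hU : coreAdm a (fun x ↦ ((u x : ℝ) : ℂ))) :
    tableClosedForm a w (fun x ↦ ((|u x| : ℝ) : ℂ)) - tableClosedForm a w (fun x ↦ ((u x : ℝ) : ℂ)) =
        -4 * ∫ y, max (-u y) 0 * tableSource a w u y ∧
      Integrable (fun y ↦ max (-u y) 0 * tableSource a w u y) :=
  tableClosedForm_abs_sub_eq_source w hum hU (tableSource a w u) fun _ ↦ rfl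

/-- A form-domain ground state is not lowered by folding. [folklore] -/
theorem IsTableGround.fold_le {U : ℝ → ℂ} (hG : IsTableGround a w U) :
    tableClosedForm a w U ≤ tableClosedForm a w (fun x ↦ ((‖U x‖ : ℝ) : ℂ)) :=
  fold_le_of_minimal hG.1 hG.2.1 hG.2.2

/-- An even-sector ground state is not lowered by folding. [folklore] -/
theorem IsTableEvenGround.fold_le {U : ℝ → ℂ} (hG : IsTableEvenGround a w U) :
    tableClosedForm a w U ≤ tableClosedForm a w (fun x ↦ ((‖U x‖ : ℝ) : ℂ)) :=
  fold_le_of_evenMinimal hG.1 hG.2.1 hG.2.2.1 hG.2.2.2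

/-- An even ground state of the full class is an even-sector ground state. [folklore] -/
theorem IsTableGround.isTableEvenGround {U : ℝ → ℂ} (hG : IsTableGround a w U)
    (he : ∀ x, U (-x) = U x) : IsTableEvenGround a w U :=
  ⟨hG.1, he, hG.2.1, fun v hv _ ↦ hG.2.2 v hv⟩

/-- Rewriting `‖·‖` of a real-valued function as `|·|` inside the fold inequality. [folklore] -/
private theorem fold_real {U : ℝ → ℝ}
    (h : tableClosedForm a w (fun x ↦ ((U x : ℝ) : ℂ)) ≤
      tableClosedForm a w (fun x ↦ ((‖((U x : ℝ) : ℂ)‖ : ℝ) : ℂ))) :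
    tableClosedForm a w (fun x ↦ ((U x : ℝ) : ℂ)) ≤ tableClosedForm a w (fun x ↦ ((|U x| : ℝ) : ℂ)) := by
  have e : (fun x ↦ ((‖((U x : ℝ) : ℂ)‖ : ℝ) : ℂ)) = fun x ↦ ((|U x| : ℝ) : ℂ) := by funext x; simp
  rwa [e] at h

/-- **Jentzsch's criterion for ground states (PROVED)**: a real form-domain ground state with
`S^w_u > 0` a.e. on `{u < 0}` is `≥ 0` a.e. [folklore] -/
theorem IsTableGround.ae_nonneg_of_source_pos (hum : Measurable u)
    (hG : IsTableGround a w (fun x ↦ ((u x : ℝ) : ℂ)))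
    (hsrc : ∀ᵐ y : ℝ, u y < 0 → 0 < tableSource a w u y) : ∀ᵐ y : ℝ, 0 ≤ u y :=
  PfPersistence.ae_nonneg_of_source_pos w hum hG.1 (fold_real hG.fold_le) (tableSource a w u)
    (fun _ ↦ rfl) hsrc

/-- The even-sector version. [folklore] -/
theorem IsTableEvenGround.ae_nonneg_of_source_pos (hum : Measurable u)
    (hG : IsTableEvenGround a w (fun x ↦ ((u x : ℝ) : ℂ)))
    (hsrc : ∀ᵐ y : ℝ, u y < 0 → 0 < tableSource a w u y) : ∀ᵐ y : ℝ, 0 ≤ u y :=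
  PfPersistence.ae_nonneg_of_source_pos w hum hG.1 (fold_real hG.fold_le) (tableSource a w u)
    (fun _ ↦ rfl) hsrc

/-- **Where a node must sit (PROVED)**: a real ground state that is NOT a.e. one-signed has `S^w_u ≤ 0`
on a non-null part of `{u < 0}` and `S^w_{−u} ≤ 0` on a non-null part of `{u > 0}`. [folklore] -/
theorem IsTableGround.frequently_source_nonpos_of_not_aeOneSigned (hum : Measurable u)
    (hG : IsTableGround a w (fun x ↦ ((u x : ℝ) : ℂ))) (hn : ¬AeOneSigned u) :
    (∃ᵐ y : ℝ, u y < 0 ∧ tableSource a w u y ≤ 0) ∧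
      ∃ᵐ y : ℝ, 0 < u y ∧ tableSource a w (fun x ↦ -u x) y ≤ 0 :=
  frequently_source_nonpos_of_fold_le w hum hG.1 (fold_real hG.fold_le) _ _ (fun _ ↦ rfl)
    (fun _ ↦ rfl) hn

/-- The even-sector version. [folklore] -/
theorem IsTableEvenGround.frequently_source_nonpos_of_not_aeOneSigned (hum : Measurable u)
    (hG : IsTableEvenGround a w (fun x ↦ ((u x : ℝ) : ℂ))) (hn : ¬AeOneSigned u) :
    (∃ᵐ y : ℝ, u y < 0 ∧ tableSource a w u y ≤ 0) ∧
      ∃ᵐ y : ℝ, 0 < u y ∧ tableSource a w (fun x ↦ -u x) y ≤ 0 :=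
  frequently_source_nonpos_of_fold_le w hum hG.1 (fold_real hG.fold_le) _ _ (fun _ ↦ rfl)
    (fun _ ↦ rfl) hn

/-- **Nodelessness under the named hypothesis (PROVED implication; hypothesis TYPED).** [folklore] -/
theorem aeOneSigned_of_perronSourceDominated (h : PerronSourceDominated a w) (hum : Measurable u)
    (hG : IsTableGround a w (fun x ↦ ((u x : ℝ) : ℂ))) : AeOneSigned u :=
  aeOneSigned_of_fold_le_of_sources w hum hG.1 (fold_real hG.fold_le) _ _ (fun _ ↦ rfl)
    (fun _ ↦ rfl) (h u hum hG)

/-- The even-sector version: nodelessness of the even bottom state under `PerronSourceDominatedEven`.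
[folklore] -/
theorem aeOneSigned_of_perronSourceDominatedEven (h : PerronSourceDominatedEven a w)
    (hum : Measurable u) (hG : IsTableEvenGround a w (fun x ↦ ((u x : ℝ) : ℂ))) : AeOneSigned u :=
  aeOneSigned_of_fold_le_of_sources w hum hG.1 (fold_real hG.fold_le) _ _ (fun _ ↦ rfl)
    (fun _ ↦ rfl) (h u hum hG)

/-- **HONESTY THEOREM (PROVED): the named domination hypothesis is EQUIVALENT to nodal count `0`.**
For a one-signed state the source condition is void (no second lobe), so at the ground-state level no
domination statement is WEAKER than the conclusion: the source formulation is a quantitative READING of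
nodelessness (where a node could sit), not a cheaper sufficient condition. [folklore] -/
theorem perronSourceDominated_iff : PerronSourceDominated a w ↔ AllGroundStatesOneSigned a w := by
  refine ⟨fun h u hum hG ↦ aeOneSigned_of_perronSourceDominated h hum hG, fun h u hum hG ↦ ?_⟩
  rcases h u hum hG with h1 | h1
  · left
    filter_upwards [h1] with y hy hlt
    exact absurd hlt (not_lt.2 hy)
  · right
    filter_upwards [h1] with y hy hlt
    exact absurd hlt (not_lt.2 hy)

/-- Honesty theorem, even sector (PROVED). [folklore] -/
theorem perronSourceDominatedEven_iff :
    PerronSourceDominatedEven a w ↔ AllEvenGroundStatesOneSigned a w := by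
  refine ⟨fun h u hum hG ↦ aeOneSigned_of_perronSourceDominatedEven h hum hG, fun h u hum hG ↦ ?_⟩
  rcases h u hum hG with h1 | h1
  · left
    filter_upwards [h1] with y hy hlt
    exact absurd hlt (not_lt.2 hy)
  · right
    filter_upwards [h1] with y hy hlt
    exact absurd hlt (not_lt.2 hy)

/-- **PERRON-FAKE, class form (PROVED implication; hypotheses TYPED)**: a table that is
`PerronSourceDominated` at every window has only a.e. one-signed real form-domain ground states at
EVERY window `a > 0` — nodal count `0` with no coverage limit. [folklore] -/
theorem perronFake_allWindows (hP : ∀ a : ℝ, 0 < a → PerronSourceDominated a w) :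
    ∀ a : ℝ, 0 < a → AllGroundStatesOneSigned a w :=
  fun a ha ↦ perronSourceDominated_iff.1 (hP a ha)

/-- **The (U)-column sentence of leaf G1.01 under the typed inputs (PROVED implication)**: from a table
`PerronSourceDominated` at every window and negative on the range `R` (`NegativeAt`) one gets a table
negative on `R` all of whose real form-domain ground states, at every window, have nodal count `0`.
[folklore] -/
theorem perronFake_witness {R : Set ℝ} (hP : ∀ a : ℝ, 0 < a → PerronSourceDominated a w)
    (hN : ∀ a ∈ R, NegativeAt a w) :
    ∃ w' : ℕ → ℝ, (∀ a ∈ R, NegativeAt a w') ∧ ∀ a : ℝ, 0 < a → AllGroundStatesOneSigned a w' :=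
  ⟨w, hN, perronFake_allWindows hP⟩

end Perron

/-! ## §4 The ζ instance, named -/

section Zeta

open Summit.RiemannHypothesis.RiemannHypothesis.Theorems.PfPersistenceDownCone (zetaTable)

/-- **The typed notion is the tree's for ζ (PROVED)**: a ground state of the windowed Weil form
vanishing off `[-a, a]` is an `IsTableGround a zetaTable` state; so is the open-window truncation of
any ground state. [folklore] -/
theorem isTableGround_zetaTable_of_isWeilGroundState {a : ℝ} (ha : 0 < a) {U : ℝ → ℂ}
    (hU : IsWeilGroundState a U) (hUs : ∀ x, x ∉ Icc (-a) a → U x = 0) :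
    IsTableGround a zetaTable U :=
  zeta_minimal_of_isWeilGroundState ha hU hUs

/-- ζ inhabits the typed notion at every window that carries a ground state (PROVED). [folklore] -/
theorem isTableGround_zetaTable_weilTrunc {a : ℝ} (ha : 0 < a) {u : ℝ → ℂ}
    (hu : IsWeilGroundState a u) : IsTableGround a zetaTable (weilTrunc a u) :=
  zeta_minimal_weilTrunc ha hu

end Zeta

/-! ## §5 The named hypothesis PROVED at small windows (part 4) -/

section SmallWindowNamed

variable {a : ℝ} {w : ℕ → ℝ}

/-- **`AllGroundStatesOneSigned a w` for `0 < a ≤ 1/8` and every real table (PROVED, part 4).**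
[folklore] -/
theorem allGroundStatesOneSigned_smallWindow (ha0 : 0 < a) (ha : a ≤ 1 / 8) :
    AllGroundStatesOneSigned a w := fun _ hum hG ↦
  aeOneSigned_of_minimal_smallWindow w hum hG.1 ha0 ha hG.2.1 hG.2.2

/-- The even-sector version (PROVED, part 4). [folklore] -/
theorem allEvenGroundStatesOneSigned_smallWindow (ha0 : 0 < a) (ha : a ≤ 1 / 8) :
    AllEvenGroundStatesOneSigned a w := fun _ hum hG ↦
  aeOneSigned_of_evenMinimal_smallWindow w hum hG.1 ha0 ha
    (fun x ↦ by have h := hG.2.1 x; simp only at h; exact_mod_cast h) hG.2.2.1 hG.2.2.2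

/-- **The domination hypothesis is a THEOREM on `0 < a ≤ 1/8` (every real table).** [folklore] -/
theorem perronSourceDominated_smallWindow (ha0 : 0 < a) (ha : a ≤ 1 / 8) :
    PerronSourceDominated a w :=
  perronSourceDominated_iff.2 (allGroundStatesOneSigned_smallWindow ha0 ha)

/-- The even-sector version. [folklore] -/
theorem perronSourceDominatedEven_smallWindow (ha0 : 0 < a) (ha : a ≤ 1 / 8) :
    PerronSourceDominatedEven a w :=
  perronSourceDominatedEven_iff.2 (allEvenGroundStatesOneSigned_smallWindow ha0 ha)

end SmallWindowNamed

end Summit.RiemannHypothesis.RiemannHypothesis.Theorems.PfPersistence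

end
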